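import Mathlib
import Summits.NavierStokesRegularity.NavierStokesRegularity.Theorems.TypeIQuarterGateScarEnvelopeTypeISatelliteTowerEnergyGap

/-!
# Satellite tower for crux `ScarEnvelopeTypeI` (stmt-NavierStokesRegularity-23843) — Part W: CHAIN LIMITS of the rigid root descent; sphere persistence

Part W of nsreg-p3's ROUND-42 artefact (section `ChainLimit`): `parabolicCylinder_subset_of_dist`; W0 ★★ `abSeq_closed'''` (T0's singular-point
clause read at MOVING final-time points: scar sets are upper semicontinuous along the extracted subsequence); W1 ★★ `doublyMin_sphere_limit` (sphere
persistence: the shell-satellited doubly-minimal family is sequentially closed); W2 ★★★ `RigidRootDescent.chainLimit` / `RigidRootDescent.chainLimit_descends`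
(the flat rigid root descent has chain limits: doubly minimal, root-singular, a satellite ON the sphere of radius 1/4, exactly rated, energy-saturated);
W3/W4 `chainLimit_of_not_scarEnvelopeTypeI_wild` (wild census with the chain limit).

PROVENANCE: declaration texts VERBATIM from the HOME artefact of the instrument seat nsreg-p3 g27 (cell `pub/ns-regularity-ideate`):
`round-42/Chain42.lean` (sha16 `8681f04ed429667a`, NEW parts `partW.lean` ed7e536880a3af23 / `partX.lean` f60de1ac17788f57; a module written
against the TREE; memo `round-42/ROUND-42.md` 5522927bd2abf3bc), scored by referee ref3 g27 (`SCORE-p3-ROUND-42-0828.md`); the author cannot write under `Theorems/`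
(`perm.theorems-prover-only`); landed by the prover ns-es-p1 g5 as landing hand of record (director-ns DIRECTOR-NS #237 (3)), split into
≤ 400-line modules, `E3` spelled out, the artefact's `#guard_msgs … #print axioms` certificates not landed.
`--supports stmt-NavierStokesRegularity-23843 --as helper`.

HONEST FRAMING: instrument theorems about HYPOTHETICAL Type-I zoom limits (Albritton–Barker objects of the census of crux
`TypeIQuarterGate.ScarEnvelopeTypeI`, item 23843); the analytic input is the tree's closure engine (compactness
`local_typeI_compactness_twin_inBall`, sharpened to constant 1 in Part S1; Q1 whole-space), P1 rate inheritance, L8 persistence and the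
tree's PROVED small-constant Liouville theorem; Parts R/S are order theory on the re-classing and closure lemmas.  NOTHING OPEN IS
PROVED: 23843, (L′) `TypeILiouvilleAB` / (L′₀), the GLOBAL (S∞) = `CritAttained`, (M𝐈₁), (E1⁺), (E2ᵣ), route ExtremalTypeIConstant's
cruxes, N0 and Navier–Stokes regularity are OPEN; `critRate`, `levelCrit I`, `liouvilleRate` are `sInf`s that are `0` by junk value
when the defining set is empty (every statement using them carries the nonemptiness hypothesis explicitly).
-/

-- the summit-side namespace repeats a component by design (single-conjunct summit, D-0017)
set_option linter.dupNamespace false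

open MeasureTheory Set Metric Filter Topology
open scoped ENNReal NNReal InnerProductSpace
open Literature.Analysis.FluidPDE

namespace Summit.NavierStokesRegularity.NavierStokesRegularity.Cruxes.ScarEnvelopeTypeI.ZoomDictionary

section ChainLimit

variable {U : ℝ → (EuclideanSpace ℝ (Fin 3)) → (EuclideanSpace ℝ (Fin 3))} {P : ℝ → (EuclideanSpace ℝ (Fin 3)) → ℝ}

/-- Backward cylinders at the final time with nearby centres: `Q_r((0, y₁)) ⊆ Q_R((0, y₂))` as soon
as `r + dist y₁ y₂ ≤ R` (and `0 ≤ r`). -/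
theorem parabolicCylinder_subset_of_dist {r R : ℝ} {y₁ y₂ : (EuclideanSpace ℝ (Fin 3))} (hr : 0 ≤ r)
    (h : r + dist y₁ y₂ ≤ R) :
    parabolicCylinder r (((0 : ℝ), y₁) : ℝ × (EuclideanSpace ℝ (Fin 3))) ⊆ parabolicCylinder R (((0 : ℝ), y₂) : ℝ × (EuclideanSpace ℝ (Fin 3))) := by
  have hrR : r ≤ R := le_trans (le_add_of_nonneg_right dist_nonneg) h
  intro w hw
  rw [mem_parabolicCylinder] at hw ⊢
  refine ⟨⟨?_, hw.1.2⟩, ?_⟩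
  · have h1 : r ^ 2 ≤ R ^ 2 := pow_le_pow_left₀ hr hrR 2
    have h2 := hw.1.1
    simp only at h2 ⊢
    linarith
  · calc dist w.2 y₂ ≤ dist w.2 y₁ + dist y₁ y₂ := dist_triangle _ _ _
      _ < r + dist y₁ y₂ := by linarith [hw.2]
      _ ≤ R := h

/-- ★★ **W0. SEQUENCE CLOSURE WITH PERSISTENCE OF MOVING SCARS.**  V0 (`abSeq_closed''`: T1 with
T0's cylinder-level eventual-bound clause) whose singular-point clause is exported in T0's FULL
generality at the final time, ALONG THE EXTRACTED SUBSEQUENCE `σ`: if `y j → y₀` and every `v (σ j)` is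
singular at `(0, y j)`, the limit is singular at `(0, y₀)` — the scar sets are upper semicontinuous
(Kuratowski) under the convergence (eventually `Q_{R/2}((0, y j)) ⊆ Q_R((0, y₀))`, so the approximants'
`L^∞` norms on `Q_R((0, y₀))` are `⊤`; T0's clause; transfer to the KNSS representative a.e.).  The
root clause of V0/T1 is the constant sequence `y ≡ 0`. -/
theorem abSeq_closed''' {Ms : ℕ → ℝ} {Minf : ℝ} {I : ℝ≥0∞} (hI : I < ⊤)
    (v : ℕ → ℝ → (EuclideanSpace ℝ (Fin 3)) → (EuclideanSpace ℝ (Fin 3))) (q : ℕ → ℝ → (EuclideanSpace ℝ (Fin 3)) → ℝ) (Gz : ℕ → ℝ → (EuclideanSpace ℝ (Fin 3)) → (EuclideanSpace ℝ (Fin 3)) →L[ℝ] (EuclideanSpace ℝ (Fin 3)))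
    (hAB : ∀ k, ABTower (Ms k) (v k) (q k) (Gz k))
    (hbd : ∀ k, typeIBound (Iio (0 : ℝ) ×ˢ univ) (v k) (q k) (Gz k) ≤ I)
    (hM : Tendsto Ms atTop (𝓝 Minf)) :
    ∃ (U' : ℝ → (EuclideanSpace ℝ (Fin 3)) → (EuclideanSpace ℝ (Fin 3))) (P' : ℝ → (EuclideanSpace ℝ (Fin 3)) → ℝ) (H' : ℝ → (EuclideanSpace ℝ (Fin 3)) → (EuclideanSpace ℝ (Fin 3)) →L[ℝ] (EuclideanSpace ℝ (Fin 3))) (σ : ℕ → ℕ),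
      StrictMono σ ∧ ABTower Minf U' P' H' ∧ typeIBound (Iio (0 : ℝ) ×ˢ univ) U' P' H' ≤ I ∧
      (∀ I' : ℝ≥0∞, (∀ᶠ k in atTop, ∀ m : ℕ, m ≤ k →
          typeIBound (parabolicCylinder ((2 : ℝ) ^ m) (0 : ℝ × (EuclideanSpace ℝ (Fin 3)))) (v k) (q k) (Gz k) ≤ I') →
        typeIBound (Iio (0 : ℝ) ×ˢ univ) U' P' H' ≤ I') ∧
      (∀ R : ℝ, 0 < R → MemLp (Function.uncurry U') 3
        (volume.restrict (parabolicCylinder R (0 : ℝ × (EuclideanSpace ℝ (Fin 3)))))) ∧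
      (∀ R : ℝ, 0 < R → Tendsto (fun j => eLpNorm
        (Function.uncurry (v (σ j)) - Function.uncurry U') 3
        (volume.restrict (parabolicCylinder R (0 : ℝ × (EuclideanSpace ℝ (Fin 3)))))) atTop (𝓝 0)) ∧
      (∀ (y : ℕ → (EuclideanSpace ℝ (Fin 3))) (y₀ : (EuclideanSpace ℝ (Fin 3))), Tendsto y atTop (𝓝 y₀) → (∀ j, ¬ RegPt (v (σ j)) (y j)) →
        ¬ RegPt U' y₀) := by
  have hcc_pos : ∀ m : ℕ, (0 : ℝ) < (2 : ℝ) ^ m := fun m => by positivity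
  have hballs : ∀ m k : ℕ, IsSuitableWeakSolutionInBall ((2 : ℝ) ^ m) (0 : ℝ × (EuclideanSpace ℝ (Fin 3))) (v k) (q k) :=
    fun m k => (hAB k).2.1 _ (hcc_pos m)
  have hQsl : ∀ ρ : ℝ, (parabolicCylinderOpens ρ (0 : ℝ × (EuclideanSpace ℝ (Fin 3))) : TopologicalSpace.Opens (ℝ × (EuclideanSpace ℝ (Fin 3)))) ≤
      slab (EuclideanSpace ℝ (Fin 3)) (Iio 0) isOpen_Iio := fun ρ w hw => parabolicCylinder_origin_subset_slab ρ hw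
  have hgrads : ∀ m k : ℕ,
      HasWeakSpatialGradientOn (parabolicCylinderOpens ((2 : ℝ) ^ m) (0 : ℝ × (EuclideanSpace ℝ (Fin 3)))) (v k) (Gz k) :=
    fun m k => (hAB k).2.2.1.mono (hQsl _)
  have hIs : ∀ m k : ℕ,
      typeIBound (parabolicCylinder ((2 : ℝ) ^ m) (0 : ℝ × (EuclideanSpace ℝ (Fin 3)))) (v k) (q k) (Gz k) ≤ I :=
    fun m k => (typeIBound_mono (parabolicCylinder_origin_subset_slab _)).trans (hbd k)
  -- ## compactness with the liminf energy clause (T0)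
  obtain ⟨Ut, Pt, Ht, σ, hσ, hIBU, hswU, hHU, h4, hmemU, hconvU, hpers⟩ :=
    Summit.NavierStokesRegularity.NavierStokesRegularity.Cruxes.ScarEnvelopeTypeI.SliceBudget.local_typeI_compactness_twin_inBall_evt
      I v q Gz hI (fun m k _ => hballs m k) (fun m k _ => hgrads m k) (fun m k _ => hIs m k)
  have h4I : typeIBound (Iio (0 : ℝ) ×ˢ univ) Ut Pt Ht ≤ I :=
    h4 I (Eventually.of_forall fun k m _ => hIs m k)
  -- ## nonnegativity of the classes and of the limit class
  have hMk : ∀ k, 0 ≤ Ms k := fun k => by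
    have h := (hAB k).1.2.2.2 (-1) (by norm_num) 0
    rw [neg_neg, Real.sqrt_one, div_one] at h
    exact (norm_nonneg _).trans h
  have hMinf : 0 ≤ Minf := ge_of_tendsto' hM hMk
  -- ## the rate `M_∞/√(−t)` of the limit, a.e.
  have hrate_ae : ∀ᵐ w ∂(volume.restrict (Iio (0 : ℝ) ×ˢ (univ : Set (EuclideanSpace ℝ (Fin 3))))),
      ‖Ut w.1 w.2‖ ≤ Minf / Real.sqrt (-w.1) := by
    have hQ : ∀ m : ℕ, ∀ᵐ w ∂(volume.restrict (parabolicCylinder ((2 : ℝ) ^ m) (0 : ℝ × (EuclideanSpace ℝ (Fin 3))))),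
        ‖Ut w.1 w.2‖ ≤ Minf / Real.sqrt (-w.1) := by
      intro m
      have hmeas : ∀ j, AEStronglyMeasurable (Function.uncurry (v (σ j)))
          (volume.restrict (parabolicCylinder ((2 : ℝ) ^ m) (0 : ℝ × (EuclideanSpace ℝ (Fin 3))))) := fun j =>
        (hballs m (σ j)).1.distributional.1.aestronglyMeasurable
      obtain ⟨ψ, hψ, hae⟩ := exists_subseq_tendsto_ae₃ hmeas (hmemU _ (hcc_pos m)).1
        (hconvU _ (hcc_pos m))
      filter_upwards [hae, ae_restrict_mem (isOpen_parabolicCylinder _ _).measurableSet]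
        with w hw hwmem
      have hw0 : w.1 < 0 := by
        have h1 := ((mem_parabolicCylinder).1 hwmem).1.2
        simpa using h1
      have hlim : Tendsto (fun i => Ms (σ (ψ i)) / Real.sqrt (-w.1)) atTop
          (𝓝 (Minf / Real.sqrt (-w.1))) :=
        ((hM.comp hσ.tendsto_atTop).comp hψ.tendsto_atTop).div_const _
      exact le_of_tendsto_of_tendsto hw.norm hlim
        (Eventually.of_forall fun i => (hAB (σ (ψ i))).1.2.2.2 _ hw0 _)
    have hcover : (Iio (0 : ℝ) ×ˢ (univ : Set (EuclideanSpace ℝ (Fin 3)))) ⊆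
        ⋃ m : ℕ, parabolicCylinder ((2 : ℝ) ^ m) (0 : ℝ × (EuclideanSpace ℝ (Fin 3))) := by
      rintro ⟨t, x⟩ ⟨ht', -⟩
      obtain ⟨m, hm⟩ := exists_mem_parabolicCylinder_two_pow₃ (mem_Iio.1 ht') x
      exact mem_iUnion.2 ⟨m, hm⟩
    exact ae_restrict_of_ae_restrict_of_subset hcover ((ae_restrict_iUnion_iff _ _).2 hQ)
  -- ## representatives: the rate everywhere, then continuous Oseen-mild (KNSS)
  obtain ⟨U₁, hae₁, hdec₁⟩ := exists_repr_hasTypeITimeDecay hMinf hrate_ae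
  have hae₁' : ∀ᵐ w ∂(volume.restrict ((slab (EuclideanSpace ℝ (Fin 3)) (Iio 0) isOpen_Iio :
      TopologicalSpace.Opens (ℝ × (EuclideanSpace ℝ (Fin 3)))) : Set (ℝ × (EuclideanSpace ℝ (Fin 3))))),
      Function.uncurry Ut w = Function.uncurry U₁ w := by
    rw [coe_slab]
    exact hae₁
  have hsw₁ : IsSuitableWeakSolutionOn (slab (EuclideanSpace ℝ (Fin 3)) (Iio 0) isOpen_Iio) 1 0 U₁ Pt :=
    hswU.congr_ae hae₁' (ae_of_all _ fun _ => rfl)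
  have hI₁ : typeIBound (Iio (0 : ℝ) ×ˢ univ) U₁ Pt Ht < ⊤ := by
    rw [← typeIBound_congr_ae hae₁]
    exact lt_of_le_of_lt h4I hI
  obtain ⟨U', hae₂, hUc, hUdiv, hUmild, hUrate⟩ :=
    exists_oseenMild_repr_of_typeIBound_lt_top hsw₁ hdec₁ hI₁
  have hae : ∀ᵐ w ∂(volume.restrict (Iio (0 : ℝ) ×ˢ (univ : Set (EuclideanSpace ℝ (Fin 3))))),
      Function.uncurry Ut w = Function.uncurry U' w := by
    filter_upwards [hae₁, hae₂] with w h1 h2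
    rw [h1, h2]
  have hae' : ∀ᵐ w ∂(volume.restrict ((slab (EuclideanSpace ℝ (Fin 3)) (Iio 0) isOpen_Iio :
      TopologicalSpace.Opens (ℝ × (EuclideanSpace ℝ (Fin 3)))) : Set (ℝ × (EuclideanSpace ℝ (Fin 3))))),
      Function.uncurry Ut w = Function.uncurry U' w := by
    rw [coe_slab]
    exact hae
  have hTI : IsTypeIAncientMild Minf U' :=
    LocalTypeIBlowup.isTypeIAncientMild_of_continuous_oseenMild_rate hUc hUdiv hUmild hUrate
  have hIBU' : ∀ a : ℝ, 0 < a → IsSuitableWeakSolutionInBall a (0 : ℝ × (EuclideanSpace ℝ (Fin 3))) U' Pt := fun a ha =>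
    (hIBU a ha).congr_ae'
      (ae_restrict_of_ae_restrict_of_subset (parabolicCylinder_origin_subset_slab a) hae)
      (ae_of_all _ fun _ => rfl)
  have hHU' : HasWeakSpatialGradientOn (slab (EuclideanSpace ℝ (Fin 3)) (Iio 0) isOpen_Iio) U' Ht := hHU.congr_ae hae'
  have hIU'le : typeIBound (Iio (0 : ℝ) ×ˢ univ) U' Pt Ht ≤ I := by
    rw [← typeIBound_congr_ae hae]
    exact h4I
  have hIU' : typeIBound (Iio (0 : ℝ) ×ˢ univ) U' Pt Ht < ⊤ := lt_of_le_of_lt hIU'le hI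
  refine ⟨U', Pt, Ht, σ, hσ, ⟨hTI, hIBU', hHU', hIU'⟩, hIU'le, fun I' hI' => ?_, fun R hR => ?_,
    fun R hR => ?_, fun y y₀ hy hsing => ?_⟩
  · -- the cylinder-level eventual-bound clause survives the change of representative
    rw [← typeIBound_congr_ae hae]
    exact h4 I' hI'
  · -- `U' ∈ L³(Q_R(0))` for every `R > 0`
    exact (hmemU R hR).ae_eq
      (ae_restrict_of_ae_restrict_of_subset (parabolicCylinder_origin_subset_slab R) hae)
  · -- `L³_loc` convergence along `σ` to the representative
    have haeR : ∀ᵐ w ∂(volume.restrict (parabolicCylinder R (0 : ℝ × (EuclideanSpace ℝ (Fin 3))))),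
        Function.uncurry Ut w = Function.uncurry U' w :=
      ae_restrict_of_ae_restrict_of_subset (parabolicCylinder_origin_subset_slab R) hae
    refine (hconvU R hR).congr' (Eventually.of_forall fun j => ?_)
    exact eLpNorm_congr_ae (haeR.mono fun w hw => by simp only [Pi.sub_apply, hw])
  · -- ## moving singular points persist (T0's clause at the point `(0, y₀)`)
    have hsingU : IsBackwardSingularPoint Ut (((0 : ℝ), y₀) : ℝ × (EuclideanSpace ℝ (Fin 3))) := by
      refine hpers (((0 : ℝ), y₀) : ℝ × (EuclideanSpace ℝ (Fin 3))) (by simp) fun R hR => ?_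
      have hR2 : 0 < R / 2 := half_pos hR.1
      have hev : ∀ᶠ j in atTop, eLpNorm (Function.uncurry (v (σ j))) ⊤
          (volume.restrict (parabolicCylinder R (((0 : ℝ), y₀) : ℝ × (EuclideanSpace ℝ (Fin 3))))) = ⊤ := by
        have h1 : ∀ᶠ j in atTop, y j ∈ ball y₀ (R / 2) := hy.eventually_mem (ball_mem_nhds _ hR2)
        filter_upwards [h1] with j hj
        have hsub : parabolicCylinder (R / 2) (((0 : ℝ), y j) : ℝ × (EuclideanSpace ℝ (Fin 3))) ⊆
            parabolicCylinder R (((0 : ℝ), y₀) : ℝ × (EuclideanSpace ℝ (Fin 3))) :=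
          parabolicCylinder_subset_of_dist hR2.le (by rw [mem_ball] at hj; linarith)
        have h2 := eLpNorm_top_eq_top_of_not_regPt (hsing j) hR2
        exact top_le_iff.1 (h2.symm.le.trans
          (eLpNorm_mono_measure _ (Measure.restrict_mono hsub le_rfl)))
      rw [Filter.limsup_congr hev, Filter.limsup_const]
    intro hr
    apply not_regPt_of_isBackwardSingularPoint hsingU
    have haeR : ∀ᵐ z ∂(volume.restrict (parabolicCylinder (‖y₀‖ + 1) (0 : ℝ × (EuclideanSpace ℝ (Fin 3))))),
        U' z.1 z.2 = Ut z.1 z.2 :=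
      (ae_restrict_of_ae_restrict_of_subset (parabolicCylinder_origin_subset_slab _) hae).mono
        fun w hw => hw.symm
    exact regPt_congr_ae (by linarith [norm_nonneg y₀]) haeR hr

/-- ★★ **W1. SPHERE PERSISTENCE — the shell-satellited doubly-minimal family is sequentially closed.**
A sequence of doubly-minimal objects of the level `I`, each carrying a scar ON THE SPHERE `‖y‖ = r`,
has a subsequence converging in `L³(Q_R(0))` for every `R` to a DOUBLY-MINIMAL object of the same
level carrying a scar on the SAME sphere (recorded as the node's point), and more generally EVERY limit point of scars of the
approximants along the subsequence is a scar of the limit.  (Compactness of the sphere first, then W0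
along the subsequence with constant class `M_c(I)` and constant bound `minLevel I`; exact criticality
of the limit and the squeeze `𝐈 ≤ minLevel I ≤ 𝐈`.) -/
theorem doublyMin_sphere_limit {I : ℝ≥0∞} {r : ℝ} (c : ℕ → TNode) (hc : ∀ k, DoublyMin I (c k))
    (hs : ∀ k, ∃ y : (EuclideanSpace ℝ (Fin 3)), ‖y‖ = r ∧ ¬ RegPt (c k).U y) :
    ∃ (n : TNode) (φ : ℕ → ℕ), StrictMono φ ∧ DoublyMin I n ∧ ‖n.y‖ = r ∧ ¬ RegPt n.U n.y ∧
      (∀ R : ℝ, 0 < R → Tendsto (fun j => eLpNorm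
        (Function.uncurry (c (φ j)).U - Function.uncurry n.U) 3
        (volume.restrict (parabolicCylinder R (0 : ℝ × (EuclideanSpace ℝ (Fin 3)))))) atTop (𝓝 0)) ∧
      (∀ (y : ℕ → (EuclideanSpace ℝ (Fin 3))) (y₀ : (EuclideanSpace ℝ (Fin 3))), Tendsto y atTop (𝓝 y₀) → (∀ j, ¬ RegPt (c (φ j)).U (y j)) →
        ¬ RegPt n.U y₀) := by
  choose y hy using hs
  obtain ⟨y₀, hy₀, ψ, hψ, hlim⟩ := (isCompact_sphere (0 : (EuclideanSpace ℝ (Fin 3))) r).tendsto_subseq (x := y)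
    (fun k => mem_sphere_zero_iff_norm.2 (hy k).1)
  have hT : ∀ k, ABTower (levelCrit I) (c (ψ k)).U (c (ψ k)).P (c (ψ k)).H :=
    fun k => (hc (ψ k)).1.1.1
  have hlev : ∀ k, (c (ψ k)).level = minLevel I := fun k => (hc (ψ k)).2
  have hmin_lt : minLevel I < ⊤ := by
    rw [← hlev 0]
    exact (hT 0).2.2.2
  have hminI : minLevel I ≤ I := by
    rw [← hlev 0]
    exact (hc (ψ 0)).1.2
  obtain ⟨U', P', H', σ, hσ, hAB, hle, -, -, hconv, hmov⟩ := abSeq_closed''' hmin_lt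
    (fun k => (c (ψ k)).U) (fun k => (c (ψ k)).P) (fun k => (c (ψ k)).H) hT
    (fun k => (hlev k).le) tendsto_const_nhds
  have hroot : ¬ RegPt U' 0 :=
    hmov (fun _ => 0) 0 tendsto_const_nhds fun j => (hc (ψ (σ j))).1.1.2
  have hsat : ¬ RegPt U' y₀ :=
    hmov (y ∘ ψ ∘ σ) y₀ (hlim.comp hσ.tendsto_atTop) fun j => (hy (ψ (σ j))).2
  have hEx : ExactCrit I ⟨U', P', H', y₀⟩ := ⟨⟨hAB, hroot⟩, hle.trans hminI⟩
  exact ⟨⟨U', P', H', y₀⟩, ψ ∘ σ, hψ.comp hσ, ⟨hEx, le_antisymm hle (minLevel_le hEx)⟩,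
    mem_sphere_zero_iff_norm.1 hy₀, hsat, hconv, hmov⟩

/-- ★★★ **W2. THE LIMIT OF THE FLAT RIGID ROOT DESCENT** — the first CHAIN limit of the census.  A rigid
root descent `c` (doubly-minimal, non-tame, `RootDescends (c k) (c (k+1))`: every `c (k+1)` is a root
blow-up of `c k` carrying a satellite on the sphere `‖y‖ = 1/4`) has a subsequence of `(c (k+1))_k`
converging in `L³(Q_R(0))`, every `R`, to an object `n` which is DOUBLY MINIMAL of the same level,
SINGULAR AT ITS ROOT, carries a SATELLITE ON THE SPHERE `1/4`, contains among its scars EVERY limit point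
of scars of the chain along the subsequence, and whose every scar is rated EXACTLY `M_c(I)` and
ENERGY-SATURATED (`𝐈(Q_ρ((0, y'))) = minLevel I` for all `ρ > 0`; no energy defect: the chain's energies
are all `minLevel I` and so is the limit's). -/
theorem RigidRootDescent.chainLimit {I : ℝ≥0∞} (h : RigidRootDescent I) :
    ∃ (c : ℕ → TNode) (n : TNode) (φ : ℕ → ℕ), StrictMono φ ∧
      (∀ k, DoublyMin I (c k) ∧ ¬ TameRoot (c k) ∧ RootDescends (c k) (c (k + 1))) ∧
      DoublyMin I n ∧ ¬ RegPt n.U 0 ∧ ‖n.y‖ = 1 / 4 ∧ n.y ∈ satellites n.U ∧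
      (∀ R : ℝ, 0 < R → Tendsto (fun j => eLpNorm
        (Function.uncurry (c (φ j + 1)).U - Function.uncurry n.U) 3
        (volume.restrict (parabolicCylinder R (0 : ℝ × (EuclideanSpace ℝ (Fin 3)))))) atTop (𝓝 0)) ∧
      (∀ (y : ℕ → (EuclideanSpace ℝ (Fin 3))) (y₀ : (EuclideanSpace ℝ (Fin 3))), Tendsto y atTop (𝓝 y₀) → (∀ j, ¬ RegPt (c (φ j + 1)).U (y j)) →
        ¬ RegPt n.U y₀) ∧
      (∀ y' : (EuclideanSpace ℝ (Fin 3)), ¬ RegPt n.U y' → tightRate n.U y' = levelCrit I ∧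
        ∀ ρ : ℝ, 0 < ρ →
          typeIBound (parabolicCylinder ρ (((0 : ℝ), y') : ℝ × (EuclideanSpace ℝ (Fin 3)))) n.U n.P n.H = minLevel I) := by
  obtain ⟨c, hc⟩ := h
  obtain ⟨n, φ, hφ, hn, hny, hsat, hconv, husc⟩ := doublyMin_sphere_limit (I := I) (r := 1 / 4)
    (fun k => c (k + 1)) (fun k => (hc (k + 1)).1)
    (fun k => by
      obtain ⟨L, Ū, -, -, hnorm, hsat⟩ := (hc k).2.2
      exact ⟨(c (k + 1)).y, hnorm, hsat.2⟩)
  have hy0 : n.y ≠ 0 := by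
    intro h0
    rw [h0, norm_zero] at hny
    norm_num at hny
  exact ⟨c, n, φ, hφ, hc, hn, hn.1.1.2, hny, ⟨hy0, hsat⟩, hconv, husc, fun y' hy' =>
    ⟨hn.1.tightRate_eq hy', fun ρ hρ => hn.energy_local_eq hy' hρ⟩⟩

/-- ★★ **W3. IN THE WILD BRANCH THE CHAIN LIMIT DESCENDS AGAIN.**  If no doubly-minimal object of
the level is tame, every chain limit of W2 is non-tame at its root and ROOT-DESCENDS to a
doubly-minimal object of the same level (U1): the set of chain limits is mapped into the rigid
root descents — the renormalisation has a non-empty recurrent part inside the doubly-minimal,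
shell-satellited, saturated family. -/
theorem RigidRootDescent.chainLimit_descends {I : ℝ≥0∞} (h : RigidRootDescent I)
    (hW : ∀ n : TNode, DoublyMin I n → ¬ TameRoot n) :
    ∃ (n n' : TNode), DoublyMin I n ∧ ‖n.y‖ = 1 / 4 ∧ n.y ∈ satellites n.U ∧ ¬ TameRoot n ∧
      DoublyMin I n' ∧ n'.level = n.level ∧ RootDescends n n' ∧
      (∀ ρ : ℝ, 0 < ρ →
        typeIBound (parabolicCylinder ρ (((0 : ℝ), n'.y) : ℝ × (EuclideanSpace ℝ (Fin 3)))) n'.U n'.P n'.H = minLevel I) := by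
  obtain ⟨c, n, φ, -, -, hn, -, hny, hsat, -, -, -⟩ := h.chainLimit
  have hnt : ¬ TameRoot n := hW n hn
  rcases hn.root_step with ht | ⟨n', hn', hlev, hd⟩
  · exact absurd ht hnt
  · refine ⟨n, n', hn, hny, hsat, hnt, hn', hlev, hd, fun ρ hρ => ?_⟩
    obtain ⟨L, Ū, -, -, -, hsat'⟩ := hd
    exact hn'.energy_local_eq hsat'.2 hρ

/-- ★★ **W4. THE WILD CENSUS WITH THE CHAIN LIMIT.**  If 23843 fails and the violator's level has no
tame doubly-minimal object, then at that level there is a doubly-minimal object which is a CHAIN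
LIMIT of a flat rigid root descent: singular root, a satellite on the sphere `1/4`, all scars exactly
`M_c(I₀)`-rated and energy-saturated, non-tame, and root-descending again inside the family. -/
theorem chainLimit_of_not_scarEnvelopeTypeI_wild
    (h : ¬ Summit.NavierStokesRegularity.NavierStokesRegularity.Theses.TypeIQuarterGate.ScarEnvelopeTypeI) :
    ∃ (M : ℝ) (I₀ : ℝ≥0∞), I₀ < ⊤ ∧ (levelRates I₀).Nonempty ∧ levelCrit I₀ ∈ Icc epsL M ∧
      minLevel I₀ ≤ I₀ ∧
      ((∃ (n : TNode) (A : ℝ), DoublyMin I₀ n ∧ TameRoot n ∧ LeafNode n ∧ EnvNode A n) ∨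
       ((∀ n : TNode, DoublyMin I₀ n → ¬ TameRoot n) ∧
        ∃ (c : ℕ → TNode) (n : TNode) (φ : ℕ → ℕ), StrictMono φ ∧
          (∀ k, DoublyMin I₀ (c k) ∧ ¬ TameRoot (c k) ∧ RootDescends (c k) (c (k + 1))) ∧
          DoublyMin I₀ n ∧ ¬ RegPt n.U 0 ∧ ‖n.y‖ = 1 / 4 ∧ n.y ∈ satellites n.U ∧ ¬ TameRoot n ∧
          (∀ R : ℝ, 0 < R → Tendsto (fun j => eLpNorm
            (Function.uncurry (c (φ j + 1)).U - Function.uncurry n.U) 3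
            (volume.restrict (parabolicCylinder R (0 : ℝ × (EuclideanSpace ℝ (Fin 3)))))) atTop (𝓝 0)) ∧
          (∀ (y : ℕ → (EuclideanSpace ℝ (Fin 3))) (y₀ : (EuclideanSpace ℝ (Fin 3))), Tendsto y atTop (𝓝 y₀) →
            (∀ j, ¬ RegPt (c (φ j + 1)).U (y j)) → ¬ RegPt n.U y₀) ∧
          (∀ y' : (EuclideanSpace ℝ (Fin 3)), ¬ RegPt n.U y' → tightRate n.U y' = levelCrit I₀ ∧
            ∀ ρ : ℝ, 0 < ρ →
              typeIBound (parabolicCylinder ρ (((0 : ℝ), y') : ℝ × (EuclideanSpace ℝ (Fin 3)))) n.U n.P n.H = minLevel I₀) ∧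
          (∃ n' : TNode, DoublyMin I₀ n' ∧ n'.level = n.level ∧ RootDescends n n'))) := by
  obtain ⟨M, I₀, hI₀, hne, hMc, hmin, hbr⟩ := tame_or_wild_of_not_scarEnvelopeTypeI h
  refine ⟨M, I₀, hI₀, hne, hMc, hmin, ?_⟩
  rcases hbr with htame | ⟨hW, hRD, -⟩
  · exact Or.inl htame
  · right
    obtain ⟨c, n, φ, hφ, hc, hn, hroot, hny, hsat, hconv, husc, hsc⟩ := hRD.chainLimit
    have hnt : ¬ TameRoot n := hW n hn
    refine ⟨hW, c, n, φ, hφ, hc, hn, hroot, hny, hsat, hnt, hconv, husc, hsc, ?_⟩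
    rcases hn.root_step with ht | ⟨n', hn', hlev, hd⟩
    · exact absurd ht hnt
    · exact ⟨n', hn', hlev, hd⟩

end ChainLimit

end Summit.NavierStokesRegularity.NavierStokesRegularity.Cruxes.ScarEnvelopeTypeI.ZoomDictionary
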